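import Mathlib

/-!
# Fourier inversion on `ℤ²` for summable even profiles (helpers for stub `stub_scaleRegularity`)

Elementary lattice Fourier analysis on `ℤ²` with the Brillouin square `Q = [-π,π]²`, written as the
product measure `Measure.pi (fun _ : Fin 2 => volume.restrict (Set.Icc (-π) π))`:

* orthogonality `∫_Q cos(k·z) dk = (2π)² [z = 0]` for `z ∈ ℤ²` (Fubini over the two coordinates);
* Fourier inversion for a summable EVEN profile `φ : ℤ² → ℝ` with cosine transform
  `φ̂(k) = Σ'_y φ(y) cos(k·y)`: `∫_Q φ̂(k) cos(k·y₀) dk = (2π)² φ(y₀)` (swap `∫` and `Σ'` by the `ℓ¹` bound);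
* the two consequences used by the scale-regularity stub when `φ̂ ≥ 0`: axial domination
  `|φ(y₀)| ≤ (2π)⁻² ∫_Q φ̂` and the Lipschitz-type bound
  `|φ(y) − φ(y')| ≤ (Σ_j |y_j − y'_j|) (2π)⁻² ∫_Q ‖k‖ φ̂(k) dk`.

All statements are for an arbitrary function `φ : (Fin 2 → ℤ) → ℝ`; pure theorem file, no definitions.
Sources: folklore (Fourier series on the torus); the positive-definite-function inequalities are the
`d = 2` lattice case of Berg–Christensen–Ressel 1984, ch. 3 §1.
-/

noncomputable section

namespace Summit.CriticalPhenomena.Ising3DConformalLimit.Cruxes.DirectCorrelationStableTail.SelfEnergyPickInversion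

open MeasureTheory Filter Topology Real
open scoped BigOperators

/-! ### One-dimensional integrals over `[-π, π]` -/

/-- `∫_{[-π,π]} cos(t m) dt = 2π [m = 0]` for an integer frequency `m`. -/
theorem integral_Icc_cos_mul_intCast (m : ℤ) :
    ∫ t in Set.Icc (-π) π, Real.cos (t * m) = if m = 0 then 2 * π else 0 := by
  rw [integral_Icc_eq_integral_Ioc, ← intervalIntegral.integral_of_le (by linarith [pi_pos])]
  split_ifs with hm
  · subst hm
    simp [two_mul]
  · have hm' : (m : ℝ) ≠ 0 := by exact_mod_cast hm
    simp_rw [mul_comm _ (m : ℝ)]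
    rw [intervalIntegral.integral_comp_mul_left _ hm', integral_cos, smul_eq_mul]
    have h1 : Real.sin ((m : ℝ) * π) = 0 := Real.sin_int_mul_pi m
    have h2 : Real.sin ((m : ℝ) * -π) = 0 := by
      rw [mul_neg, Real.sin_neg, h1, neg_zero]
    rw [h1, h2]; simp

/-- `∫_{[-π,π]} sin(t m) dt = 0` for an integer frequency `m`. -/
theorem integral_Icc_sin_mul_intCast (m : ℤ) :
    ∫ t in Set.Icc (-π) π, Real.sin (t * m) = 0 := by
  rw [integral_Icc_eq_integral_Ioc, ← intervalIntegral.integral_of_le (by linarith [pi_pos])]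
  by_cases hm : m = 0
  · subst hm; simp
  · have hm' : (m : ℝ) ≠ 0 := by exact_mod_cast hm
    simp_rw [mul_comm _ (m : ℝ)]
    rw [intervalIntegral.integral_comp_mul_left _ hm', integral_sin, smul_eq_mul]
    have : Real.cos ((m : ℝ) * -π) = Real.cos ((m : ℝ) * π) := by rw [mul_neg, Real.cos_neg]
    rw [this, sub_self, mul_zero]

/-! ### The Brillouin square `Q = [-π,π]²` as a product measure -/

/-- Total mass of the square: `|Q| = (2π)²`. -/
theorem box_real_univ :
    (Measure.pi fun _ : Fin 2 => (volume : Measure ℝ).restrict (Set.Icc (-π) π)).real Set.univ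
      = (2 * π) ^ 2 := by
  rw [Measure.real, Measure.pi_univ]
  simp only [Measure.restrict_apply_univ, Real.volume_Icc, Finset.prod_const, Finset.card_univ,
    Fintype.card_fin]
  rw [ENNReal.toReal_pow, ENNReal.toReal_ofReal (by linarith [pi_pos])]
  ring

/-- The product measure on the square is Lebesgue measure on `ℝ²` restricted to `[-π,π]²`. -/
theorem box_eq_restrict :
    (Measure.pi fun _ : Fin 2 => (volume : Measure ℝ).restrict (Set.Icc (-π) π))
      = (volume : Measure (Fin 2 → ℝ)).restrict (Set.pi Set.univ fun _ => Set.Icc (-π) π) := by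
  rw [volume_pi, Measure.restrict_pi_pi]

/-- A continuous function is integrable on the (compact) square. -/
theorem integrable_box_of_continuous {f : (Fin 2 → ℝ) → ℝ} (hf : Continuous f) :
    Integrable f (Measure.pi fun _ : Fin 2 => (volume : Measure ℝ).restrict (Set.Icc (-π) π)) := by
  rw [box_eq_restrict]
  exact hf.continuousOn.integrableOn_compact (isCompact_univ_pi fun _ => isCompact_Icc)

/-- Almost every point of the square has all coordinates in `[-π, π]`. -/
theorem ae_box {P : (Fin 2 → ℝ) → Prop} (h : ∀ k : Fin 2 → ℝ, (∀ j, |k j| ≤ π) → P k) :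
    ∀ᵐ k ∂(Measure.pi fun _ : Fin 2 => (volume : Measure ℝ).restrict (Set.Icc (-π) π)), P k := by
  rw [box_eq_restrict, ae_restrict_iff' (MeasurableSet.univ_pi fun _ => measurableSet_Icc)]
  exact ae_of_all _ fun k hk => h k fun j => abs_le.2 (Set.mem_univ_pi.1 hk j)

/-- Orthogonality of lattice characters: `∫_Q cos(k·z) dk = (2π)² [z = 0]` for `z ∈ ℤ²`. -/
theorem integral_box_cos (z : Fin 2 → ℤ) :
    ∫ k, Real.cos (∑ j, k j * (z j : ℝ))
        ∂(Measure.pi fun _ : Fin 2 => (volume : Measure ℝ).restrict (Set.Icc (-π) π))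
      = if z = 0 then (2 * π) ^ 2 else 0 := by
  have h : ∀ k : Fin 2 → ℝ, Real.cos (∑ j, k j * (z j : ℝ)) =
      (∏ j, Real.cos (k j * (z j : ℝ))) - ∏ j, Real.sin (k j * (z j : ℝ)) := by
    intro k
    simp only [Fin.sum_univ_two, Fin.prod_univ_two, Real.cos_add]
  simp_rw [h]
  rw [integral_sub, integral_fintype_prod_eq_prod (fun j t => Real.cos (t * (z j : ℝ))),
    integral_fintype_prod_eq_prod (fun j t => Real.sin (t * (z j : ℝ)))]
  · simp only [integral_Icc_cos_mul_intCast, integral_Icc_sin_mul_intCast, Fin.prod_univ_two,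
      mul_zero, sub_zero]
    have hz : z = 0 ↔ z 0 = 0 ∧ z 1 = 0 := by
      constructor
      · rintro rfl; simp
      · rintro ⟨h0, h1⟩; funext j; fin_cases j <;> simp [h0, h1]
    by_cases h0 : z 0 = 0 <;> by_cases h1 : z 1 = 0 <;> simp [h0, h1, hz, sq]
  · exact integrable_box_of_continuous (by fun_prop)
  · exact integrable_box_of_continuous (by fun_prop)

/-- Product of two lattice characters integrated over the square:
`∫_Q cos(k·y) cos(k·z) dk = ((2π)²/2)([y = z] + [y = -z])`. -/
theorem integral_box_cos_mul_cos (y z : Fin 2 → ℤ) :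
    ∫ k, Real.cos (∑ j, k j * (y j : ℝ)) * Real.cos (∑ j, k j * (z j : ℝ))
        ∂(Measure.pi fun _ : Fin 2 => (volume : Measure ℝ).restrict (Set.Icc (-π) π))
      = (2 * π) ^ 2 / 2 * ((if y = z then 1 else 0) + (if y = -z then 1 else 0)) := by
  have h : ∀ k : Fin 2 → ℝ, Real.cos (∑ j, k j * (y j : ℝ)) * Real.cos (∑ j, k j * (z j : ℝ)) =
      (1 / 2) * (Real.cos (∑ j, k j * ((y - z) j : ℝ)) + Real.cos (∑ j, k j * ((y + z) j : ℝ))) := by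
    intro k
    have e1 : ∑ j, k j * ((y - z) j : ℝ) = ∑ j, k j * (y j : ℝ) - ∑ j, k j * (z j : ℝ) := by
      simp [mul_sub, Finset.sum_sub_distrib]
    have e2 : ∑ j, k j * ((y + z) j : ℝ) = ∑ j, k j * (y j : ℝ) + ∑ j, k j * (z j : ℝ) := by
      simp [mul_add, Finset.sum_add_distrib]
    rw [e1, e2, Real.cos_sub, Real.cos_add]; ring
  simp_rw [h]
  rw [integral_const_mul, integral_add, integral_box_cos, integral_box_cos]
  · simp only [sub_eq_zero, add_eq_zero_iff_eq_neg]
    split_ifs <;> ring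
  · exact integrable_box_of_continuous (by fun_prop)
  · exact integrable_box_of_continuous (by fun_prop)

/-! ### The cosine transform of a summable profile -/

/-- The cosine transform `k ↦ Σ'_y φ(y) cos(k·y)` of a summable profile is continuous. -/
theorem continuous_cosTransform {φ : (Fin 2 → ℤ) → ℝ} (hφ : Summable φ) :
    Continuous fun k : Fin 2 → ℝ => ∑' y, φ y * Real.cos (∑ j, k j * (y j : ℝ)) :=
  continuous_tsum (fun y => by fun_prop) hφ.abs fun y k => by
    rw [Real.norm_eq_abs, abs_mul]
    exact mul_le_of_le_one_right (abs_nonneg _) (Real.abs_cos_le_one _)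

/-- The cosine transform is bounded by the `ℓ¹` norm: `|φ̂(k)| ≤ Σ'_y |φ(y)|`. -/
theorem abs_cosTransform_le {φ : (Fin 2 → ℤ) → ℝ} (hφ : Summable φ) (k : Fin 2 → ℝ) :
    |∑' y, φ y * Real.cos (∑ j, k j * (y j : ℝ))| ≤ ∑' y, |φ y| := by
  have hle : ∀ y, |φ y * Real.cos (∑ j, k j * (y j : ℝ))| ≤ |φ y| := fun y => by
    rw [abs_mul]; exact mul_le_of_le_one_right (abs_nonneg _) (Real.abs_cos_le_one _)
  have hs : Summable fun y => |φ y * Real.cos (∑ j, k j * (y j : ℝ))| :=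
    Summable.of_nonneg_of_le (fun _ => abs_nonneg _) hle hφ.abs
  calc |∑' y, φ y * Real.cos (∑ j, k j * (y j : ℝ))|
      ≤ ∑' y, |φ y * Real.cos (∑ j, k j * (y j : ℝ))| := by
        have := norm_tsum_le_tsum_norm (f := fun y => φ y * Real.cos (∑ j, k j * (y j : ℝ)))
          (by simpa [Real.norm_eq_abs] using hs)
        simpa [Real.norm_eq_abs] using this
    _ ≤ ∑' y, |φ y| := hs.tsum_le_tsum hle hφ.abs

/-- The cosine transform times a continuous function is integrable on the square. -/
theorem integrable_box_cosTransform_mul {φ : (Fin 2 → ℤ) → ℝ} (hφ : Summable φ)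
    {g : (Fin 2 → ℝ) → ℝ} (hg : Continuous g) :
    Integrable (fun k : Fin 2 → ℝ => (∑' y, φ y * Real.cos (∑ j, k j * (y j : ℝ))) * g k)
      (Measure.pi fun _ : Fin 2 => (volume : Measure ℝ).restrict (Set.Icc (-π) π)) :=
  integrable_box_of_continuous ((continuous_cosTransform hφ).mul hg)

/-- The cosine transform, multiplied on the left by a continuous weight, is integrable on the square. -/
theorem integrable_box_mul_cosTransform {φ : (Fin 2 → ℤ) → ℝ} (hφ : Summable φ)
    {g : (Fin 2 → ℝ) → ℝ} (hg : Continuous g) :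
    Integrable (fun k : Fin 2 → ℝ => g k * ∑' y, φ y * Real.cos (∑ j, k j * (y j : ℝ)))
      (Measure.pi fun _ : Fin 2 => (volume : Measure ℝ).restrict (Set.Icc (-π) π)) :=
  integrable_box_of_continuous (hg.mul (continuous_cosTransform hφ))

/-- The cosine transform of a summable profile is integrable on the square. -/
theorem integrable_box_cosTransform {φ : (Fin 2 → ℤ) → ℝ} (hφ : Summable φ) :
    Integrable (fun k : Fin 2 → ℝ => ∑' y, φ y * Real.cos (∑ j, k j * (y j : ℝ)))
      (Measure.pi fun _ : Fin 2 => (volume : Measure ℝ).restrict (Set.Icc (-π) π)) :=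
  integrable_box_of_continuous (continuous_cosTransform hφ)

/-! ### Fourier inversion for even summable profiles -/

/-- **Fourier inversion on `ℤ²`** for a summable even profile:
`∫_Q φ̂(k) cos(k·y₀) dk = (2π)² φ(y₀)`, where `φ̂(k) = Σ'_y φ(y) cos(k·y)`. -/
theorem integral_cosTransform_mul_cos {φ : (Fin 2 → ℤ) → ℝ} (hφ : Summable φ)
    (heven : ∀ y, φ (-y) = φ y) (y₀ : Fin 2 → ℤ) :
    ∫ k, (∑' y, φ y * Real.cos (∑ j, k j * (y j : ℝ))) * Real.cos (∑ j, k j * (y₀ j : ℝ))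
        ∂(Measure.pi fun _ : Fin 2 => (volume : Measure ℝ).restrict (Set.Icc (-π) π))
      = (2 * π) ^ 2 * φ y₀ := by
  have step1 : ∀ k : Fin 2 → ℝ,
      (∑' y, φ y * Real.cos (∑ j, k j * (y j : ℝ))) * Real.cos (∑ j, k j * (y₀ j : ℝ))
        = ∑' y, φ y * (Real.cos (∑ j, k j * (y j : ℝ)) * Real.cos (∑ j, k j * (y₀ j : ℝ))) := by
    intro k
    rw [← tsum_mul_right]
    exact tsum_congr fun y => by ring
  simp_rw [step1]
  rw [← integral_tsum_of_summable_integral_norm]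
  · simp_rw [integral_const_mul, integral_box_cos_mul_cos]
    have key : ∀ y, φ y * ((2 * π) ^ 2 / 2 * ((if y = y₀ then 1 else 0) + (if y = -y₀ then 1 else 0)))
        = (2 * π) ^ 2 / 2 * ((if y = y₀ then φ y else 0) + (if y = -y₀ then φ y else 0)) := by
      intro y
      split_ifs <;> ring
    simp_rw [key]
    rw [tsum_mul_left, Summable.tsum_add, tsum_ite_eq y₀ φ, tsum_ite_eq (-y₀) φ, heven]
    · ring
    · exact summable_of_ne_finset_zero (s := {y₀}) fun y hy => by
        rw [Finset.mem_singleton] at hy; simp [hy]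
    · exact summable_of_ne_finset_zero (s := {-y₀}) fun y hy => by
        rw [Finset.mem_singleton] at hy; simp [hy]
  · intro y
    exact (integrable_box_of_continuous (by fun_prop)).const_mul _
  · refine Summable.of_nonneg_of_le (fun y => integral_nonneg fun _ => norm_nonneg _) (fun y => ?_)
      (hφ.abs.mul_right ((2 * π) ^ 2))
    calc ∫ k, ‖φ y * (Real.cos (∑ j, k j * (y j : ℝ)) * Real.cos (∑ j, k j * (y₀ j : ℝ)))‖
          ∂(Measure.pi fun _ : Fin 2 => (volume : Measure ℝ).restrict (Set.Icc (-π) π))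
        ≤ ∫ _k, |φ y| ∂(Measure.pi fun _ : Fin 2 => (volume : Measure ℝ).restrict (Set.Icc (-π) π)) := by
          refine integral_mono_of_nonneg (ae_of_all _ fun _ => norm_nonneg _) (integrable_const _)
            (ae_of_all _ fun k => ?_)
          dsimp only
          rw [Real.norm_eq_abs, abs_mul, abs_mul]
          exact mul_le_of_le_one_right (abs_nonneg _)
            (mul_le_one₀ (Real.abs_cos_le_one _) (abs_nonneg _) (Real.abs_cos_le_one _))
      _ = |φ y| * (2 * π) ^ 2 := by rw [integral_const, box_real_univ, smul_eq_mul, mul_comm]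

/-! ### Consequences for profiles with nonnegative cosine transform -/

/-- **Axial domination.** If `φ` is summable and even with `φ̂ ≥ 0`, then
`|φ(y₀)| ≤ (2π)⁻² ∫_Q φ̂(k) dk` for every `y₀`. -/
theorem abs_le_integral_cosTransform {φ : (Fin 2 → ℤ) → ℝ} (hφ : Summable φ)
    (heven : ∀ y, φ (-y) = φ y)
    (hpos : ∀ k : Fin 2 → ℝ, 0 ≤ ∑' y, φ y * Real.cos (∑ j, k j * (y j : ℝ))) (y₀ : Fin 2 → ℤ) :
    |φ y₀| ≤ (1 / (2 * π) ^ 2) * ∫ k, (∑' y, φ y * Real.cos (∑ j, k j * (y j : ℝ)))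
        ∂(Measure.pi fun _ : Fin 2 => (volume : Measure ℝ).restrict (Set.Icc (-π) π)) := by
  have hpi : (0 : ℝ) < (2 * π) ^ 2 := by positivity
  have h1 : |φ y₀| = (1 / (2 * π) ^ 2) *
      |∫ k, (∑' y, φ y * Real.cos (∑ j, k j * (y j : ℝ))) * Real.cos (∑ j, k j * (y₀ j : ℝ))
        ∂(Measure.pi fun _ : Fin 2 => (volume : Measure ℝ).restrict (Set.Icc (-π) π))| := by
    rw [integral_cosTransform_mul_cos hφ heven y₀, abs_mul, abs_of_pos hpi]
    field_simp
  rw [h1]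
  refine mul_le_mul_of_nonneg_left ?_ (by positivity)
  refine (abs_integral_le_integral_abs).trans ?_
  refine integral_mono (integrable_box_cosTransform_mul hφ (by fun_prop)).abs
    (integrable_box_cosTransform hφ) fun k => ?_
  simp only
  rw [abs_mul, abs_of_nonneg (hpos k)]
  exact mul_le_of_le_one_right (hpos k) (Real.abs_cos_le_one _)

/-- The phase `k·y` is Lipschitz in `y` for the `ℓ¹` distance with constant `‖k‖` (sup norm). -/
theorem abs_cos_phase_sub_le (k : Fin 2 → ℝ) (y y' : Fin 2 → ℤ) :
    |Real.cos (∑ j, k j * (y j : ℝ)) - Real.cos (∑ j, k j * (y' j : ℝ))|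
      ≤ ‖k‖ * ∑ j, |(y j : ℝ) - y' j| := by
  refine (Real.abs_cos_sub_cos_le _ _).trans ?_
  rw [← Finset.sum_sub_distrib, Finset.mul_sum]
  refine (Finset.abs_sum_le_sum_abs _ _).trans (Finset.sum_le_sum fun j _ => ?_)
  rw [← mul_sub, abs_mul]
  refine mul_le_mul_of_nonneg_right ?_ (abs_nonneg _)
  have := norm_le_pi_norm k j
  rwa [Real.norm_eq_abs] at this

/-- **Lipschitz bound.** If `φ` is summable and even with `φ̂ ≥ 0`, then
`|φ(y) − φ(y')| ≤ (Σ_j |y_j − y'_j|) · (2π)⁻² ∫_Q ‖k‖ φ̂(k) dk`. -/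
theorem abs_sub_le_integral_norm_mul_cosTransform {φ : (Fin 2 → ℤ) → ℝ} (hφ : Summable φ)
    (heven : ∀ y, φ (-y) = φ y)
    (hpos : ∀ k : Fin 2 → ℝ, 0 ≤ ∑' y, φ y * Real.cos (∑ j, k j * (y j : ℝ))) (y y' : Fin 2 → ℤ) :
    |φ y - φ y'| ≤ (∑ j, |(y j : ℝ) - y' j|) * ((1 / (2 * π) ^ 2) *
      ∫ k, ‖k‖ * (∑' z, φ z * Real.cos (∑ j, k j * (z j : ℝ)))
        ∂(Measure.pi fun _ : Fin 2 => (volume : Measure ℝ).restrict (Set.Icc (-π) π))) := by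
  have hpi : (0 : ℝ) < (2 * π) ^ 2 := by positivity
  set D : ℝ := ∑ j, |(y j : ℝ) - y' j| with hD
  have hD0 : 0 ≤ D := Finset.sum_nonneg fun _ _ => abs_nonneg _
  have hiy := integrable_box_cosTransform_mul hφ
    (g := fun k : Fin 2 → ℝ => Real.cos (∑ j, k j * (y j : ℝ))) (by fun_prop)
  have hiy' := integrable_box_cosTransform_mul hφ
    (g := fun k : Fin 2 → ℝ => Real.cos (∑ j, k j * (y' j : ℝ))) (by fun_prop)
  have h1 : φ y - φ y' = (1 / (2 * π) ^ 2) *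
      ∫ k, (∑' z, φ z * Real.cos (∑ j, k j * (z j : ℝ))) *
          (Real.cos (∑ j, k j * (y j : ℝ)) - Real.cos (∑ j, k j * (y' j : ℝ)))
        ∂(Measure.pi fun _ : Fin 2 => (volume : Measure ℝ).restrict (Set.Icc (-π) π)) := by
    simp_rw [mul_sub]
    rw [integral_sub hiy hiy', integral_cosTransform_mul_cos hφ heven y,
      integral_cosTransform_mul_cos hφ heven y']
    field_simp
  rw [h1, abs_mul, abs_of_pos (by positivity : (0 : ℝ) < 1 / (2 * π) ^ 2), mul_left_comm]
  refine mul_le_mul_of_nonneg_left ?_ (by positivity)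
  refine (abs_integral_le_integral_abs).trans ?_
  rw [← integral_const_mul]
  refine integral_mono (integrable_box_cosTransform_mul hφ (g := fun k : Fin 2 → ℝ =>
      Real.cos (∑ j, k j * (y j : ℝ)) - Real.cos (∑ j, k j * (y' j : ℝ))) (by fun_prop)).abs
    ((integrable_box_mul_cosTransform hφ continuous_norm).const_mul D) fun k => ?_
  simp only
  rw [abs_mul, abs_of_nonneg (hpos k)]
  calc (∑' z, φ z * Real.cos (∑ j, k j * (z j : ℝ))) *
        |Real.cos (∑ j, k j * (y j : ℝ)) - Real.cos (∑ j, k j * (y' j : ℝ))|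
      ≤ (∑' z, φ z * Real.cos (∑ j, k j * (z j : ℝ))) * (‖k‖ * D) :=
        mul_le_mul_of_nonneg_left (abs_cos_phase_sub_le k y y') (hpos k)
    _ = D * (‖k‖ * ∑' z, φ z * Real.cos (∑ j, k j * (z j : ℝ))) := by ring

/-! ### Registered helper sub-goal -/

/-- **Registered helper sub-goal `stub_scaleRegularity_auxFourier`** of stub `stub_scaleRegularity`
(line `self-energy-pick-inversion`, crux stmt-CriticalPhenomena-4799): for a summable even profile
`φ : ℤ² → ℝ` with nonnegative cosine transform `φ̂`, axial domination `|φ(y)| ≤ (2π)⁻² ∫_Q φ̂` and the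
Lipschitz bound `|φ(y) − φ(y')| ≤ (Σ_j |y_j − y'_j|) (2π)⁻² ∫_Q ‖k‖ φ̂(k) dk` on the Brillouin square. -/
theorem stub_scaleRegularity_auxFourier :
    ∀ (φ : (Fin 2 → ℤ) → ℝ), Summable φ → (∀ y, φ (-y) = φ y) →
    (∀ k : Fin 2 → ℝ, 0 ≤ ∑' y : Fin 2 → ℤ, φ y * Real.cos (∑ j, k j * (y j : ℝ))) →
    ∀ y y' : Fin 2 → ℤ,
    |φ y| ≤ (1 / (2 * Real.pi) ^ 2) * ∫ k, (∑' z : Fin 2 → ℤ, φ z * Real.cos (∑ j, k j * (z j : ℝ)))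
      ∂(MeasureTheory.Measure.pi fun _ : Fin 2 => (MeasureTheory.volume : MeasureTheory.Measure
      ℝ).restrict (Set.Icc (-Real.pi) Real.pi)) ∧
    |φ y - φ y'| ≤ (∑ j, |(y j : ℝ) - y' j|) * ((1 / (2 * Real.pi) ^ 2) * ∫ k, ‖k‖ * (∑' z : Fin 2
      → ℤ, φ z * Real.cos (∑ j, k j * (z j : ℝ))) ∂(MeasureTheory.Measure.pi fun _ : Fin 2 =>
      (MeasureTheory.volume : MeasureTheory.Measure ℝ).restrict (Set.Icc (-Real.pi) Real.pi))) :=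
  fun _φ hφ heven hpos y y' =>
    ⟨abs_le_integral_cosTransform hφ heven hpos y,
      abs_sub_le_integral_norm_mul_cosTransform hφ heven hpos y y'⟩

end Summit.CriticalPhenomena.Ising3DConformalLimit.Cruxes.DirectCorrelationStableTail.SelfEnergyPickInversion

end
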